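import Summits.HubbardSuperconductivity.HubbardSuperconductivity.Theorems.ThermalWedgeTwSeededEnsembleEquivalenceRBlockProduct
import Summits.HubbardSuperconductivity.HubbardSuperconductivity.Theorems.ThermalWedgeTwSeededEnsembleEquivalenceRLogPartitionCalculus
import Literature.MathematicalPhysics.QuantumLattice.GibbsStateSecondMoments
import Literature.MathematicalPhysics.QuantumLattice.SourcedHubbardBlockCut

/-!
# Crux `TwSeededEnsembleEquivalenceR` (stmt-HubbardSuperconductivity-15581), line `cold-floor-collapse` (slug `Sketch`),
# skeleton v8 (block two-phase pinning) — registered stub `stub_trialMoments`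

Support file (`--supports stmt-HubbardSuperconductivity-15581`; sorry-free; no definition).
S4's two-phase trial Hamiltonian `K̃(μA, μB) = T₀ − μA N_A − μB N_B − μs N_R` (`stub_blockProduct`, whose seven conjuncts are
re-exported with a larger constant) together with its first two number moments:

(i) `Re⟨N_A⟩_{K̃} = a · Re⟨N⟩_{Rect_M(μA)}` and `Re⟨N_B⟩_{K̃} = (K² − a) · Re⟨N⟩_{Rect_M(μB)}`: differentiate the separability
identity `log Z(K̃(μA, μB)) = a log Z_M(μA) + (K² − a) log Z_M(μB) + R` in `μA` and in `μB` (`stub_logPartitionCalculus` (i) on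
the torus, with `T = T₀ − μB N_B − μs N_R`, and on the block, with `Rect_M(μ) = Rect_M(0) − μ N`; `HasDerivAt.unique`);

(ii) `Re⟨(N − c)²⟩_{K̃} ≤ 6 (Re⟨N⟩_{K̃} − c)² + C (1 + √(β|h|)) L² M²`: `N = N_A + N_B + N_R` (disjoint cover), centring and
`Re⟨(ΣXᵢ)²⟩ ≤ 3 Σ Re⟨Xᵢ²⟩` (`GibbsStateSecondMoments.lean`); `Var N_R ≤ (#S_R)² ≤ 36 L² M²`; for `N_A` (same for `N_B`) the
Falk–Bruch conjunct of `stub_logPartitionCalculus` (iii): `Var N_A ≤ b_A + ½ √(β b_A c_A)` with the truncated Duhamel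
function `b_A = D_A / β²`, where the response `D_A` of `β Re⟨N_A⟩` is `a` times the block response `D_M ≤ β² Var_M ≤ β² (2M²)²`
by (i) and `HasDerivAt.unique`, so `b_A ≤ 4 L² M²` (`a M² ≤ L²`), and the double commutator
`c_A = Re⟨[N_A, [K̃, N_A]]⟩ = Re⟨[N_A, [T₀, N_A]]⟩ ≤ C|h|L²` (the diagonal chemical-potential terms commute with `N_A`).
Dyson–Lieb–Simon (1978) §3; Bratteli–Robinson II §5.3.1. [folklore]
-/

set_option linter.dupNamespace false

namespace Summit.HubbardSuperconductivity.HubbardSuperconductivity.Theorems.TwSeededEnsembleEquivalenceR.ColdFloorLine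

open Matrix Filter Topology Finset Literature.MathematicalPhysics.QuantumLattice
open Literature.Barriers.HubbardSuperconductivity Literature.Probability.LatticeModels
open scoped ComplexOrder Matrix.Norms.L2Operator

noncomputable section

/-! ### Helper lemmas (prefixed `tm_`) -/

/-- **Abstract first and second number moments of a separable two-phase trial state.** On a finite-dimensional space with
Hermitian `T₀` and pairwise commuting Hermitian "numbers" `N_A, N_B, N_R`, `N = N_A + N_B + N_R`, put
`K̃(μA, μB) = T₀ − μA N_A − μB N_B − μs N_R`; on a second space let `Hb(μ) = T_M − μ N_M` (Hermitian). If
`log Z_β(K̃(μA, μB)) = a log Z_β(Hb μA) + b log Z_β(Hb μB) + R` for all `μA, μB` (`a, b ≥ 0`), `Re⟨N_M²⟩ ≤ ρM` and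
`Re⟨N_R²⟩ ≤ ρR` in every Gibbs state, and `‖[N_X, [T₀, N_X]]‖ ≤ c_X` (`X = A, B`), then
(i) `Re⟨N_A⟩_{K̃} = a Re⟨N_M⟩_{Hb μA}`, `Re⟨N_B⟩_{K̃} = b Re⟨N_M⟩_{Hb μB}` and
(ii) `Re⟨(N − c)²⟩_{K̃} ≤ (Re⟨N⟩_{K̃} − c)² + 3 ((a ρM + ½√(β a ρM c_A)) + (b ρM + ½√(β b ρM c_B)) + ρR)`
(`stub_logPartitionCalculus` three times, `HasDerivAt.unique` twice, `GibbsStateSecondMoments`). [folklore] -/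
theorem tm_abstractMoments {n m : Type} [Fintype n] [DecidableEq n] [Nonempty n] [Fintype m] [DecidableEq m] [Nonempty m]
    {T₀ NA NB NR N : Matrix n n ℂ} {TM NM : Matrix m m ℂ} {Hb : ℝ → Matrix m m ℂ} {μs a b ρM ρR cA cB β : ℝ}
    (hHb : ∀ μ : ℝ, Hb μ = TM - (μ : ℂ) • NM) (hTM : TM.IsHermitian) (hNM : NM.IsHermitian)
    (hT₀ : T₀.IsHermitian) (hNA : NA.IsHermitian) (hNB : NB.IsHermitian) (hNR : NR.IsHermitian)
    (hAB : NA * NB = NB * NA) (hAR : NA * NR = NR * NA) (hBR : NB * NR = NR * NB) (hN : N = NA + NB + NR)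
    (ha : 0 ≤ a) (hb : 0 ≤ b) (hβ : 0 < β)
    (hρM : ∀ (β' : ℝ) (H : Matrix m m ℂ), H.IsHermitian → (Matrix.gibbsState β' H (NM * NM)).re ≤ ρM)
    (hρR : ∀ (β' : ℝ) (H : Matrix n n ℂ), H.IsHermitian → (Matrix.gibbsState β' H (NR * NR)).re ≤ ρR)
    (hcA : ‖NA * (T₀ * NA - NA * T₀) - (T₀ * NA - NA * T₀) * NA‖ ≤ cA)
    (hcB : ‖NB * (T₀ * NB - NB * T₀) - (T₀ * NB - NB * T₀) * NB‖ ≤ cB)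
    (hsep : ∃ R : ℝ, ∀ μA μB : ℝ, Real.log (Matrix.partitionFn β (T₀ - (μA : ℂ) • NA - (μB : ℂ) • NB - (μs : ℂ) • NR)).re =
      a * Real.log (Matrix.partitionFn β (Hb μA)).re + b * Real.log (Matrix.partitionFn β (Hb μB)).re + R) :
    (∀ μA μB : ℝ,
      (Matrix.gibbsState β (T₀ - (μA : ℂ) • NA - (μB : ℂ) • NB - (μs : ℂ) • NR) NA).re = a * (Matrix.gibbsState β (Hb μA) NM).re ∧
      (Matrix.gibbsState β (T₀ - (μA : ℂ) • NA - (μB : ℂ) • NB - (μs : ℂ) • NR) NB).re = b * (Matrix.gibbsState β (Hb μB) NM).re) ∧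
    (∀ μA μB c : ℝ,
      (Matrix.gibbsState β (T₀ - (μA : ℂ) • NA - (μB : ℂ) • NB - (μs : ℂ) • NR) ((N - (c : ℂ) • 1) * (N - (c : ℂ) • 1))).re ≤
        ((Matrix.gibbsState β (T₀ - (μA : ℂ) • NA - (μB : ℂ) • NB - (μs : ℂ) • NR) N).re - c) ^ 2 +
          3 * ((a * ρM + 1 / 2 * Real.sqrt (β * (a * ρM) * cA)) + (b * ρM + 1 / 2 * Real.sqrt (β * (b * ρM) * cB)) + ρR)) := by
  obtain ⟨R, hR⟩ := hsep
  -- Hermitian partial Hamiltonians and the two other ways of writing `K̃`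
  have hTA : ∀ μB : ℝ, (T₀ - (μB : ℂ) • NB - (μs : ℂ) • NR).IsHermitian := fun μB =>
    isHermitian_sub_smul (isHermitian_sub_smul hT₀ hNB μB) hNR μs
  have hTB : ∀ μA : ℝ, (T₀ - (μA : ℂ) • NA - (μs : ℂ) • NR).IsHermitian := fun μA =>
    isHermitian_sub_smul (isHermitian_sub_smul hT₀ hNA μA) hNR μs
  have hKA : ∀ μA μB : ℝ, T₀ - (μB : ℂ) • NB - (μs : ℂ) • NR - (μA : ℂ) • NA = T₀ - (μA : ℂ) • NA - (μB : ℂ) • NB - (μs : ℂ) • NR :=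
    fun μA μB => by abel
  have hKB : ∀ μA μB : ℝ, T₀ - (μA : ℂ) • NA - (μs : ℂ) • NR - (μB : ℂ) • NB = T₀ - (μA : ℂ) • NA - (μB : ℂ) • NB - (μs : ℂ) • NR :=
    fun μA μB => by abel
  have hK : ∀ μA μB : ℝ, (T₀ - (μA : ℂ) • NA - (μB : ℂ) • NB - (μs : ℂ) • NR).IsHermitian := fun μA μB =>
    isHermitian_sub_smul (isHermitian_sub_smul (isHermitian_sub_smul hT₀ hNA μA) hNB μB) hNR μs
  have hHbh : ∀ μ : ℝ, (Hb μ).IsHermitian := fun μ => by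
    rw [hHb μ]
    exact isHermitian_sub_smul hTM hNM μ
  -- `stub_logPartitionCalculus` on the torus (in `μA` at fixed `μB`, in `μB` at fixed `μA`) and on the block
  have S5A := fun μB : ℝ => stub_logPartitionCalculus n (T₀ - (μB : ℂ) • NB - (μs : ℂ) • NR) NA (hTA μB) hNA β hβ
  have S5B := fun μA : ℝ => stub_logPartitionCalculus n (T₀ - (μA : ℂ) • NA - (μs : ℂ) • NR) NB (hTB μA) hNB β hβ
  have S5M := stub_logPartitionCalculus m TM NM hTM hNM β hβ
  have hZM : ∀ μ : ℝ, HasDerivAt (fun μ' : ℝ => Real.log (Matrix.partitionFn β (Hb μ')).re)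
      (β * (Matrix.gibbsState β (Hb μ) NM).re) μ := by
    intro μ
    have h1 := S5M.1 μ
    simp only [← hHb] at h1
    exact h1
  -- (i) the block densities, by uniqueness of the `μA`- and `μB`-derivatives of the separability identity
  have hiA : ∀ μA μB : ℝ, (Matrix.gibbsState β (T₀ - (μA : ℂ) • NA - (μB : ℂ) • NB - (μs : ℂ) • NR) NA).re =
      a * (Matrix.gibbsState β (Hb μA) NM).re := by
    intro μA μB
    have h1 : HasDerivAt (fun μ' : ℝ => Real.log (Matrix.partitionFn β (T₀ - (μ' : ℂ) • NA - (μB : ℂ) • NB - (μs : ℂ) • NR)).re)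
        (β * (Matrix.gibbsState β (T₀ - (μA : ℂ) • NA - (μB : ℂ) • NB - (μs : ℂ) • NR) NA).re) μA := by
      have h2 := (S5A μB).1 μA
      simp only [hKA] at h2
      exact h2
    have h2 : HasDerivAt (fun μ' : ℝ => Real.log (Matrix.partitionFn β (T₀ - (μ' : ℂ) • NA - (μB : ℂ) • NB - (μs : ℂ) • NR)).re)
        (a * (β * (Matrix.gibbsState β (Hb μA) NM).re)) μA := by
      refine (((hZM μA).const_mul a).add_const (b * Real.log (Matrix.partitionFn β (Hb μB)).re + R)).congr_of_eventuallyEq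
        (Filter.Eventually.of_forall fun μ' => ?_)
      beta_reduce
      rw [hR μ' μB, add_assoc]
    exact mul_left_cancel₀ hβ.ne' ((h1.unique h2).trans (by ring))
  have hiB : ∀ μA μB : ℝ, (Matrix.gibbsState β (T₀ - (μA : ℂ) • NA - (μB : ℂ) • NB - (μs : ℂ) • NR) NB).re =
      b * (Matrix.gibbsState β (Hb μB) NM).re := by
    intro μA μB
    have h1 : HasDerivAt (fun μ' : ℝ => Real.log (Matrix.partitionFn β (T₀ - (μA : ℂ) • NA - (μ' : ℂ) • NB - (μs : ℂ) • NR)).re)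
        (β * (Matrix.gibbsState β (T₀ - (μA : ℂ) • NA - (μB : ℂ) • NB - (μs : ℂ) • NR) NB).re) μB := by
      have h2 := (S5B μA).1 μB
      simp only [hKB] at h2
      exact h2
    have h2 : HasDerivAt (fun μ' : ℝ => Real.log (Matrix.partitionFn β (T₀ - (μA : ℂ) • NA - (μ' : ℂ) • NB - (μs : ℂ) • NR)).re)
        (b * (β * (Matrix.gibbsState β (Hb μB) NM).re)) μB := by
      refine ((((hZM μB).const_mul b).const_add (a * Real.log (Matrix.partitionFn β (Hb μA)).re)).add_const R).congr_of_eventuallyEq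
        (Filter.Eventually.of_forall fun μ' => ?_)
      beta_reduce
      exact hR μA μ'
    exact mul_left_cancel₀ hβ.ne' ((h1.unique h2).trans (by ring))
  refine ⟨fun μA μB => ⟨hiA μA μB, hiB μA μB⟩, fun μA μB c => ?_⟩
  -- (ii) the block response: `D_M / β² ≤ Var_M ≤ ρM`
  have hDM : ∀ μ : ℝ, ∃ D : ℝ, HasDerivAt (fun μ' : ℝ => β * (Matrix.gibbsState β (Hb μ') NM).re) D μ ∧ 0 ≤ D ∧ D / β ^ 2 ≤ ρM := by
    intro μ
    obtain ⟨D, hD, hD0, hDle, -⟩ := S5M.2.2 μ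
    simp only [← hHb] at hD hDle
    refine ⟨D, hD, hD0, ?_⟩
    rw [div_le_iff₀ (pow_pos hβ 2)]
    have h1 := hρM β (Hb μ) (hHbh μ)
    have h2 : (Matrix.gibbsState β (Hb μ) (NM * NM)).re - (Matrix.gibbsState β (Hb μ) NM).re ^ 2 ≤ ρM := by
      nlinarith [sq_nonneg (Matrix.gibbsState β (Hb μ) NM).re]
    calc D ≤ β ^ 2 * ((Matrix.gibbsState β (Hb μ) (NM * NM)).re - (Matrix.gibbsState β (Hb μ) NM).re ^ 2) := hDle
      _ ≤ β ^ 2 * ρM := mul_le_mul_of_nonneg_left h2 (sq_nonneg β)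
      _ = ρM * β ^ 2 := mul_comm _ _
  -- the variance of `N_A`: Falk–Bruch with `b_A = D_A/β² = a D_M/β² ≤ a ρM` and `c_A ≤ ‖[N_A, [T₀, N_A]]‖`
  have hVA : (Matrix.gibbsState β (T₀ - (μA : ℂ) • NA - (μB : ℂ) • NB - (μs : ℂ) • NR) (NA * NA)).re -
      (Matrix.gibbsState β (T₀ - (μA : ℂ) • NA - (μB : ℂ) • NB - (μs : ℂ) • NR) NA).re ^ 2 ≤
        a * ρM + 1 / 2 * Real.sqrt (β * (a * ρM) * cA) := by
    obtain ⟨DA, hDA, hDA0, -, hFB⟩ := (S5A μB).2.2 μA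
    simp only [hKA] at hDA hFB
    rw [tm_doubleComm_sub_smul_of_comm NA _ NR (μs : ℂ) hAR, tm_doubleComm_sub_smul_of_comm NA _ NB (μB : ℂ) hAB,
      tm_doubleComm_sub_smul_of_comm NA T₀ NA (μA : ℂ) rfl] at hFB
    obtain ⟨DM, hDM', -, hDMρ⟩ := hDM μA
    have hDA' : HasDerivAt (fun μ' : ℝ => β * (Matrix.gibbsState β (T₀ - (μ' : ℂ) • NA - (μB : ℂ) • NB - (μs : ℂ) • NR) NA).re) (a * DM) μA := by
      refine (hDM'.const_mul a).congr_of_eventuallyEq (Filter.Eventually.of_forall fun μ' => ?_)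
      beta_reduce
      rw [hiA μ' μB]
      ring
    have hbA : DA / β ^ 2 ≤ a * ρM := by
      rw [hDA.unique hDA', mul_div_assoc]
      exact mul_le_mul_of_nonneg_left hDMρ ha
    have hbA0 : 0 ≤ DA / β ^ 2 := div_nonneg hDA0 (pow_pos hβ 2).le
    have hdc : (Matrix.gibbsState β (T₀ - (μA : ℂ) • NA - (μB : ℂ) • NB - (μs : ℂ) • NR) (NA * (T₀ * NA - NA * T₀) - (T₀ * NA - NA * T₀) * NA)).re ≤ cA :=
      (re_gibbsState_le_norm (hK μA μB) β _).trans hcA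
    have hcA0 : 0 ≤ cA := (norm_nonneg _).trans hcA
    have hsq : Real.sqrt (β * (DA / β ^ 2) * (Matrix.gibbsState β (T₀ - (μA : ℂ) • NA - (μB : ℂ) • NB - (μs : ℂ) • NR) (NA * (T₀ * NA - NA * T₀) - (T₀ * NA - NA * T₀) * NA)).re) ≤
        Real.sqrt (β * (a * ρM) * cA) :=
      Real.sqrt_le_sqrt ((mul_le_mul_of_nonneg_left hdc (mul_nonneg hβ.le hbA0)).trans
        (mul_le_mul_of_nonneg_right (mul_le_mul_of_nonneg_left hbA hβ.le) hcA0))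
    linarith
  -- the variance of `N_B`, symmetrically
  have hVB : (Matrix.gibbsState β (T₀ - (μA : ℂ) • NA - (μB : ℂ) • NB - (μs : ℂ) • NR) (NB * NB)).re -
      (Matrix.gibbsState β (T₀ - (μA : ℂ) • NA - (μB : ℂ) • NB - (μs : ℂ) • NR) NB).re ^ 2 ≤
        b * ρM + 1 / 2 * Real.sqrt (β * (b * ρM) * cB) := by
    obtain ⟨DB, hDB, hDB0, -, hFB⟩ := (S5B μA).2.2 μB
    simp only [hKB] at hDB hFB
    rw [tm_doubleComm_sub_smul_of_comm NB _ NR (μs : ℂ) hBR, tm_doubleComm_sub_smul_of_comm NB _ NB (μB : ℂ) rfl,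
      tm_doubleComm_sub_smul_of_comm NB T₀ NA (μA : ℂ) hAB.symm] at hFB
    obtain ⟨DM, hDM', -, hDMρ⟩ := hDM μB
    have hDB' : HasDerivAt (fun μ' : ℝ => β * (Matrix.gibbsState β (T₀ - (μA : ℂ) • NA - (μ' : ℂ) • NB - (μs : ℂ) • NR) NB).re) (b * DM) μB := by
      refine (hDM'.const_mul b).congr_of_eventuallyEq (Filter.Eventually.of_forall fun μ' => ?_)
      beta_reduce
      rw [hiB μA μ']
      ring
    have hbB : DB / β ^ 2 ≤ b * ρM := by
      rw [hDB.unique hDB', mul_div_assoc]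
      exact mul_le_mul_of_nonneg_left hDMρ hb
    have hbB0 : 0 ≤ DB / β ^ 2 := div_nonneg hDB0 (pow_pos hβ 2).le
    have hdc : (Matrix.gibbsState β (T₀ - (μA : ℂ) • NA - (μB : ℂ) • NB - (μs : ℂ) • NR) (NB * (T₀ * NB - NB * T₀) - (T₀ * NB - NB * T₀) * NB)).re ≤ cB :=
      (re_gibbsState_le_norm (hK μA μB) β _).trans hcB
    have hcB0 : 0 ≤ cB := (norm_nonneg _).trans hcB
    have hsq : Real.sqrt (β * (DB / β ^ 2) * (Matrix.gibbsState β (T₀ - (μA : ℂ) • NA - (μB : ℂ) • NB - (μs : ℂ) • NR) (NB * (T₀ * NB - NB * T₀) - (T₀ * NB - NB * T₀) * NB)).re) ≤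
        Real.sqrt (β * (b * ρM) * cB) :=
      Real.sqrt_le_sqrt ((mul_le_mul_of_nonneg_left hdc (mul_nonneg hβ.le hbB0)).trans
        (mul_le_mul_of_nonneg_right (mul_le_mul_of_nonneg_left hbB hβ.le) hcB0))
    linarith
  -- the variance of `N_R` and the assembly
  have hVR : (Matrix.gibbsState β (T₀ - (μA : ℂ) • NA - (μB : ℂ) • NB - (μs : ℂ) • NR) (NR * NR)).re -
      (Matrix.gibbsState β (T₀ - (μA : ℂ) • NA - (μB : ℂ) • NB - (μs : ℂ) • NR) NR).re ^ 2 ≤ ρR := by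
    have h1 := hρR β _ (hK μA μB)
    nlinarith [sq_nonneg (Matrix.gibbsState β (T₀ - (μA : ℂ) • NA - (μB : ℂ) • NB - (μs : ℂ) • NR) NR).re]
  have hmain := tm_re_gibbsState_sub_smul_one_mul_self_le (hK μA μB) hNA hNB hNR hN β c
  linarith

/-- Chemical-potential shift of a pair-sourced Hamiltonian: `H(G, w, μ) = H(G, w, 0) − μ N`. [folklore] -/
theorem tm_sourced_shift {Λ : Type*} [LinearOrder Λ] [Fintype Λ] (G : SimpleGraph Λ) [DecidableRel G.Adj] (t U h : ℝ)
    (w : Λ × Λ → ℂ) (μ : ℝ) :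
    hamiltonianWith G t U μ - (h : ℂ) • ((∑ z : Λ × Λ, w z • bondPair z.1 z.2) + (∑ z : Λ × Λ, w z • bondPair z.1 z.2)ᴴ) =
      (hamiltonianWith G t U 0 - (h : ℂ) • ((∑ z : Λ × Λ, w z • bondPair z.1 z.2) + (∑ z : Λ × Λ, w z • bondPair z.1 z.2)ᴴ)) -
        (μ : ℂ) • totalNumber := by
  rw [hamiltonianWith_eq_sub_smul_totalNumber G t U μ, sub_right_comm]

/-- The bookkeeping of (ii): per graded block family `a (2M²)² ≤ 4 L²M²` (`a M² ≤ L²`) and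
`½ √(β · a(2M²)² · C|h|L²) ≤ √C √(β|h|) L²M²`, plus `(#S_R)² ≤ 36 L²M²`, against the constant `max C (132 + 6√C)`. [folklore] -/
theorem tm_collect {C q L M a b k sR β η y : ℝ} (hC : 0 ≤ C) (hq : 0 ≤ q) (hqC : q * q = C) (hM : 1 ≤ M)
    (ha : 0 ≤ a) (hb : 0 ≤ b) (haM : a * M ^ 2 ≤ L ^ 2) (hbM : b * M ^ 2 ≤ L ^ 2) (hk : k = M ^ 2)
    (hsR0 : 0 ≤ sR) (hsR : sR ≤ 6 * L * M) (hβ : 0 ≤ β) (hη : 0 ≤ η) (hy : 0 ≤ y) :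
    y + 3 * ((a * (2 * k) ^ 2 + 1 / 2 * Real.sqrt (β * (a * (2 * k) ^ 2) * (C * η * L ^ 2))) +
        (b * (2 * k) ^ 2 + 1 / 2 * Real.sqrt (β * (b * (2 * k) ^ 2) * (C * η * L ^ 2))) + sR ^ 2) ≤
      6 * y + max C (132 + 6 * q) * (1 + Real.sqrt (β * η)) * L ^ 2 * M ^ 2 := by
  subst hk
  have hs0 : 0 ≤ Real.sqrt (β * η) := Real.sqrt_nonneg _
  have hss : Real.sqrt (β * η) ^ 2 = β * η := Real.sq_sqrt (mul_nonneg hβ hη)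
  have hM2 : 1 ≤ M ^ 2 := one_le_pow₀ hM
  have hP0 : 0 ≤ L ^ 2 * M ^ 2 := by positivity
  -- one graded block family
  have blk : ∀ e : ℝ, 0 ≤ e → e * M ^ 2 ≤ L ^ 2 →
      e * (2 * M ^ 2) ^ 2 + 1 / 2 * Real.sqrt (β * (e * (2 * M ^ 2) ^ 2) * (C * η * L ^ 2)) ≤
        4 * (L ^ 2 * M ^ 2) + q * (Real.sqrt (β * η) * (L ^ 2 * M ^ 2)) := by
    intro e he heM
    have h1 : e * (2 * M ^ 2) ^ 2 ≤ 4 * (L ^ 2 * M ^ 2) := by nlinarith [mul_le_mul_of_nonneg_right heM (sq_nonneg M)]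
    have h2 : Real.sqrt (β * (e * (2 * M ^ 2) ^ 2) * (C * η * L ^ 2)) ≤ 2 * q * (Real.sqrt (β * η) * (L ^ 2 * M ^ 2)) := by
      refine Real.sqrt_le_iff.mpr ⟨by positivity, ?_⟩
      calc β * (e * (2 * M ^ 2) ^ 2) * (C * η * L ^ 2) = (4 * C * (β * η) * L ^ 2 * M ^ 2) * (e * M ^ 2) := by ring
        _ ≤ (4 * C * (β * η) * L ^ 2 * M ^ 2) * L ^ 2 := mul_le_mul_of_nonneg_left heM (by positivity)
        _ ≤ (4 * C * (β * η) * L ^ 2 * M ^ 2) * L ^ 2 * M ^ 2 := le_mul_of_one_le_right (by positivity) hM2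
        _ = (2 * q * (Real.sqrt (β * η) * (L ^ 2 * M ^ 2))) ^ 2 := by
            rw [show (2 * q * (Real.sqrt (β * η) * (L ^ 2 * M ^ 2))) ^ 2 =
              4 * (q * q) * Real.sqrt (β * η) ^ 2 * L ^ 2 * M ^ 2 * L ^ 2 * M ^ 2 by ring, hqC, hss]
    linarith
  have hA := blk a ha haM
  have hB := blk b hb hbM
  have hR' : sR ^ 2 ≤ 36 * (L ^ 2 * M ^ 2) := by nlinarith [pow_le_pow_left₀ hsR0 hsR 2]
  have hmax : 132 + 6 * q ≤ max C (132 + 6 * q) := le_max_right _ _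
  have hm1 : (132 + 6 * q) * (L ^ 2 * M ^ 2) ≤ max C (132 + 6 * q) * (L ^ 2 * M ^ 2) := mul_le_mul_of_nonneg_right hmax hP0
  have hm2 : (132 + 6 * q) * (Real.sqrt (β * η) * (L ^ 2 * M ^ 2)) ≤ max C (132 + 6 * q) * (Real.sqrt (β * η) * (L ^ 2 * M ^ 2)) :=
    mul_le_mul_of_nonneg_right hmax (mul_nonneg hs0 hP0)
  nlinarith [mul_nonneg hs0 hP0, mul_nonneg hq hP0, mul_nonneg hq (mul_nonneg hs0 hP0)]

/-! ### The stub -/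

/-- (registered stub `stub_trialMoments` of skeleton v8.1; statement verbatim — see Lines/Sketch.lean for the docstring) -/
theorem stub_trialMoments :
    ∃ C : ℝ, 0 ≤ C ∧ ∀ (L : ℕ) [NeZero L] (M : ℕ), 1 ≤ M → M ≤ L → ∀ (a : ℕ), a ≤ (L / M) ^ 2 →
      ∀ (U μs h : ℝ), 0 ≤ U →
        ∃ (SA SB SR : Finset (Orb (FermionTorus 2 L)))
          (T₀ : Matrix (Finset (Orb (FermionTorus 2 L))) (Finset (Orb (FermionTorus 2 L))) ℂ),
          Disjoint SA SB ∧ Disjoint SA SR ∧ Disjoint SB SR ∧ SA ∪ SB ∪ SR = Finset.univ ∧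
          ((SR.card : ℝ) ≤ 6 * L * M) ∧ T₀.IsHermitian ∧
          ‖(Matrix.diagonal fun s : Finset (Orb (FermionTorus 2 L)) => (((s ∩ SA).card : ℕ) : ℂ)) * (T₀ * (Matrix.diagonal fun s : Finset (Orb (FermionTorus 2 L)) => (((s ∩ SA).card : ℕ) : ℂ)) - (Matrix.diagonal fun s : Finset (Orb (FermionTorus 2 L)) => (((s ∩ SA).card : ℕ) : ℂ)) * T₀) - (T₀ * (Matrix.diagonal fun s : Finset (Orb (FermionTorus 2 L)) => (((s ∩ SA).card : ℕ) : ℂ)) - (Matrix.diagonal fun s : Finset (Orb (FermionTorus 2 L)) => (((s ∩ SA).card : ℕ) : ℂ)) * T₀) * (Matrix.diagonal fun s : Finset (Orb (FermionTorus 2 L)) => (((s ∩ SA).card : ℕ) : ℂ))‖ ≤ C * |h| * (L : ℝ) ^ 2 ∧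
          ‖(Matrix.diagonal fun s : Finset (Orb (FermionTorus 2 L)) => (((s ∩ SB).card : ℕ) : ℂ)) * (T₀ * (Matrix.diagonal fun s : Finset (Orb (FermionTorus 2 L)) => (((s ∩ SB).card : ℕ) : ℂ)) - (Matrix.diagonal fun s : Finset (Orb (FermionTorus 2 L)) => (((s ∩ SB).card : ℕ) : ℂ)) * T₀) - (T₀ * (Matrix.diagonal fun s : Finset (Orb (FermionTorus 2 L)) => (((s ∩ SB).card : ℕ) : ℂ)) - (Matrix.diagonal fun s : Finset (Orb (FermionTorus 2 L)) => (((s ∩ SB).card : ℕ) : ℂ)) * T₀) * (Matrix.diagonal fun s : Finset (Orb (FermionTorus 2 L)) => (((s ∩ SB).card : ℕ) : ℂ))‖ ≤ C * |h| * (L : ℝ) ^ 2 ∧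
          (∀ (β : ℝ), 0 < β → ∃ R : ℝ, |R| ≤ C * (1 + β * (U + |μs|)) * L * M ∧ ∀ (μA μB : ℝ),
            Real.log (Matrix.partitionFn β (T₀ - (μA : ℂ) • (Matrix.diagonal fun s : Finset (Orb (FermionTorus 2 L)) => (((s ∩ SA).card : ℕ) : ℂ)) - (μB : ℂ) • (Matrix.diagonal fun s : Finset (Orb (FermionTorus 2 L)) => (((s ∩ SB).card : ℕ) : ℂ)) - (μs : ℂ) • (Matrix.diagonal fun s : Finset (Orb (FermionTorus 2 L)) => (((s ∩ SR).card : ℕ) : ℂ)))).re =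
              (a : ℝ) * Real.log (Matrix.partitionFn β (hamiltonianWith ((zdGraph 2).comap (fun p : (Lex (Fin M × Fin M)) => ![((ofLex p).1 : ℤ), ((ofLex p).2 : ℤ)])) 1 U μA - (h : ℂ) • ((∑ z : (Lex (Fin M × Fin M)) × (Lex (Fin M × Fin M)), (fun z : (Lex (Fin M × Fin M)) × (Lex (Fin M × Fin M)) => (fun v : Fin 2 → ℤ => ((dWaveFormFactor v / Real.sqrt 2 : ℝ) : ℂ)) (![((ofLex z.2).1 : ℤ), ((ofLex z.2).2 : ℤ)] - ![((ofLex z.1).1 : ℤ), ((ofLex z.1).2 : ℤ)])) z • bondPair z.1 z.2) + (∑ z : (Lex (Fin M × Fin M)) × (Lex (Fin M × Fin M)), (fun z : (Lex (Fin M × Fin M)) × (Lex (Fin M × Fin M)) => (fun v : Fin 2 → ℤ => ((dWaveFormFactor v / Real.sqrt 2 : ℝ) : ℂ)) (![((ofLex z.2).1 : ℤ), ((ofLex z.2).2 : ℤ)] - ![((ofLex z.1).1 : ℤ), ((ofLex z.1).2 : ℤ)])) z • bondPair z.1 z.2)ᴴ))).re +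
                (((L / M) ^ 2 - a : ℕ) : ℝ) * Real.log (Matrix.partitionFn β (hamiltonianWith ((zdGraph 2).comap (fun p : (Lex (Fin M × Fin M)) => ![((ofLex p).1 : ℤ), ((ofLex p).2 : ℤ)])) 1 U μB - (h : ℂ) • ((∑ z : (Lex (Fin M × Fin M)) × (Lex (Fin M × Fin M)), (fun z : (Lex (Fin M × Fin M)) × (Lex (Fin M × Fin M)) => (fun v : Fin 2 → ℤ => ((dWaveFormFactor v / Real.sqrt 2 : ℝ) : ℂ)) (![((ofLex z.2).1 : ℤ), ((ofLex z.2).2 : ℤ)] - ![((ofLex z.1).1 : ℤ), ((ofLex z.1).2 : ℤ)])) z • bondPair z.1 z.2) + (∑ z : (Lex (Fin M × Fin M)) × (Lex (Fin M × Fin M)), (fun z : (Lex (Fin M × Fin M)) × (Lex (Fin M × Fin M)) => (fun v : Fin 2 → ℤ => ((dWaveFormFactor v / Real.sqrt 2 : ℝ) : ℂ)) (![((ofLex z.2).1 : ℤ), ((ofLex z.2).2 : ℤ)] - ![((ofLex z.1).1 : ℤ), ((ofLex z.1).2 : ℤ)])) z • bondPair z.1 z.2)ᴴ))).re + R) ∧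
          (∀ (β : ℝ), 0 < β → ∀ (g : ℝ), 0 < g → ∀ (μA μB : ℝ),
            (Matrix.gibbsState β (T₀ - (μA : ℂ) • (Matrix.diagonal fun s : Finset (Orb (FermionTorus 2 L)) => (((s ∩ SA).card : ℕ) : ℂ)) - (μB : ℂ) • (Matrix.diagonal fun s : Finset (Orb (FermionTorus 2 L)) => (((s ∩ SB).card : ℕ) : ℂ)) - (μs : ℂ) • (Matrix.diagonal fun s : Finset (Orb (FermionTorus 2 L)) => (((s ∩ SR).card : ℕ) : ℂ)))
                ((hubbardTorusWith 2 L 1 U μs - ((g / (L : ℝ) ^ 2 : ℝ) : ℂ) • ((pairField dWaveFormFactor L)ᴴ * pairField dWaveFormFactor L)) - (T₀ - (μA : ℂ) • (Matrix.diagonal fun s : Finset (Orb (FermionTorus 2 L)) => (((s ∩ SA).card : ℕ) : ℂ)) - (μB : ℂ) • (Matrix.diagonal fun s : Finset (Orb (FermionTorus 2 L)) => (((s ∩ SB).card : ℕ) : ℂ)) - (μs : ℂ) • (Matrix.diagonal fun s : Finset (Orb (FermionTorus 2 L)) => (((s ∩ SR).card : ℕ) : ℂ))))).re ≤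
              h ^ 2 / g * (L : ℝ) ^ 2 + (μA - μs) * (Matrix.gibbsState β (T₀ - (μA : ℂ) • (Matrix.diagonal fun s : Finset (Orb (FermionTorus 2 L)) => (((s ∩ SA).card : ℕ) : ℂ)) - (μB : ℂ) • (Matrix.diagonal fun s : Finset (Orb (FermionTorus 2 L)) => (((s ∩ SB).card : ℕ) : ℂ)) - (μs : ℂ) • (Matrix.diagonal fun s : Finset (Orb (FermionTorus 2 L)) => (((s ∩ SR).card : ℕ) : ℂ))) (Matrix.diagonal fun s : Finset (Orb (FermionTorus 2 L)) => (((s ∩ SA).card : ℕ) : ℂ))).re +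
                (μB - μs) * (Matrix.gibbsState β (T₀ - (μA : ℂ) • (Matrix.diagonal fun s : Finset (Orb (FermionTorus 2 L)) => (((s ∩ SA).card : ℕ) : ℂ)) - (μB : ℂ) • (Matrix.diagonal fun s : Finset (Orb (FermionTorus 2 L)) => (((s ∩ SB).card : ℕ) : ℂ)) - (μs : ℂ) • (Matrix.diagonal fun s : Finset (Orb (FermionTorus 2 L)) => (((s ∩ SR).card : ℕ) : ℂ))) (Matrix.diagonal fun s : Finset (Orb (FermionTorus 2 L)) => (((s ∩ SB).card : ℕ) : ℂ))).re +
                C * (1 + |h|) * ((L : ℝ) ^ 2 / M + L * M)) ∧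
          (∀ (β : ℝ), 0 < β → ∀ (μA μB : ℝ),
            (Matrix.gibbsState β (T₀ - (μA : ℂ) • (Matrix.diagonal fun s : Finset (Orb (FermionTorus 2 L)) => (((s ∩ SA).card : ℕ) : ℂ)) - (μB : ℂ) • (Matrix.diagonal fun s : Finset (Orb (FermionTorus 2 L)) => (((s ∩ SB).card : ℕ) : ℂ)) - (μs : ℂ) • (Matrix.diagonal fun s : Finset (Orb (FermionTorus 2 L)) => (((s ∩ SR).card : ℕ) : ℂ))) (Matrix.diagonal fun s : Finset (Orb (FermionTorus 2 L)) => (((s ∩ SA).card : ℕ) : ℂ))).re =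
                (a : ℝ) * (Matrix.gibbsState β (hamiltonianWith ((zdGraph 2).comap (fun p : (Lex (Fin M × Fin M)) => ![((ofLex p).1 : ℤ), ((ofLex p).2 : ℤ)])) 1 U μA - (h : ℂ) • ((∑ z : (Lex (Fin M × Fin M)) × (Lex (Fin M × Fin M)), (fun z : (Lex (Fin M × Fin M)) × (Lex (Fin M × Fin M)) => (fun v : Fin 2 → ℤ => ((dWaveFormFactor v / Real.sqrt 2 : ℝ) : ℂ)) (![((ofLex z.2).1 : ℤ), ((ofLex z.2).2 : ℤ)] - ![((ofLex z.1).1 : ℤ), ((ofLex z.1).2 : ℤ)])) z • bondPair z.1 z.2) + (∑ z : (Lex (Fin M × Fin M)) × (Lex (Fin M × Fin M)), (fun z : (Lex (Fin M × Fin M)) × (Lex (Fin M × Fin M)) => (fun v : Fin 2 → ℤ => ((dWaveFormFactor v / Real.sqrt 2 : ℝ) : ℂ)) (![((ofLex z.2).1 : ℤ), ((ofLex z.2).2 : ℤ)] - ![((ofLex z.1).1 : ℤ), ((ofLex z.1).2 : ℤ)])) z • bondPair z.1 z.2)ᴴ)) (totalNumber : Matrix (Finset (Orb (Lex (Fin M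 × Fin M)))) (Finset (Orb (Lex (Fin M × Fin M)))) ℂ)).re ∧
            (Matrix.gibbsState β (T₀ - (μA : ℂ) • (Matrix.diagonal fun s : Finset (Orb (FermionTorus 2 L)) => (((s ∩ SA).card : ℕ) : ℂ)) - (μB : ℂ) • (Matrix.diagonal fun s : Finset (Orb (FermionTorus 2 L)) => (((s ∩ SB).card : ℕ) : ℂ)) - (μs : ℂ) • (Matrix.diagonal fun s : Finset (Orb (FermionTorus 2 L)) => (((s ∩ SR).card : ℕ) : ℂ))) (Matrix.diagonal fun s : Finset (Orb (FermionTorus 2 L)) => (((s ∩ SB).card : ℕ) : ℂ))).re =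
                (((L / M) ^ 2 - a : ℕ) : ℝ) * (Matrix.gibbsState β (hamiltonianWith ((zdGraph 2).comap (fun p : (Lex (Fin M × Fin M)) => ![((ofLex p).1 : ℤ), ((ofLex p).2 : ℤ)])) 1 U μB - (h : ℂ) • ((∑ z : (Lex (Fin M × Fin M)) × (Lex (Fin M × Fin M)), (fun z : (Lex (Fin M × Fin M)) × (Lex (Fin M × Fin M)) => (fun v : Fin 2 → ℤ => ((dWaveFormFactor v / Real.sqrt 2 : ℝ) : ℂ)) (![((ofLex z.2).1 : ℤ), ((ofLex z.2).2 : ℤ)] - ![((ofLex z.1).1 : ℤ), ((ofLex z.1).2 : ℤ)])) z • bondPair z.1 z.2) + (∑ z : (Lex (Fin M × Fin M)) × (Lex (Fin M × Fin M)), (fun z : (Lex (Fin M × Fin M)) × (Lex (Fin M × Fin M)) => (fun v : Fin 2 → ℤ => ((dWaveFormFactor v / Real.sqrt 2 : ℝ) : ℂ)) (![((ofLex z.2).1 : ℤ), ((ofLex z.2).2 : ℤ)] - ![((ofLex z.1).1 : ℤ), ((ofLex z.1).2 : ℤ)])) z • bondPair z.1 z.2)ᴴ)) (totalNumber : Matrix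 (Finset (Orb (Lex (Fin M × Fin M)))) (Finset (Orb (Lex (Fin M × Fin M)))) ℂ)).re) ∧
          (∀ (β : ℝ), 0 < β → ∀ (μA μB c : ℝ),
            (Matrix.gibbsState β (T₀ - (μA : ℂ) • (Matrix.diagonal fun s : Finset (Orb (FermionTorus 2 L)) => (((s ∩ SA).card : ℕ) : ℂ)) - (μB : ℂ) • (Matrix.diagonal fun s : Finset (Orb (FermionTorus 2 L)) => (((s ∩ SB).card : ℕ) : ℂ)) - (μs : ℂ) • (Matrix.diagonal fun s : Finset (Orb (FermionTorus 2 L)) => (((s ∩ SR).card : ℕ) : ℂ))) (((totalNumber : Matrix (Finset (Orb (FermionTorus 2 L))) (Finset (Orb (FermionTorus 2 L))) ℂ) - (c : ℂ) • (1 : Matrix (Finset (Orb (FermionTorus 2 L))) (Finset (Orb (FermionTorus 2 L))) ℂ)) * ((totalNumber : Matrix (Finset (Orb (FermionTorus 2 L))) (Finset (Orb (FermionTorus 2 L))) ℂ) - (c : ℂ) • (1 : Matrix (Finset (Orb (FermionTorus 2 L))) (Finset (Orb (FermionTorus 2 L))) ℂ)))).re ≤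
              6 * ((Matrix.gibbsState β (T₀ - (μA : ℂ) • (Matrix.diagonal fun s : Finset (Orb (FermionTorus 2 L)) => (((s ∩ SA).card : ℕ) : ℂ)) - (μB : ℂ) • (Matrix.diagonal fun s : Finset (Orb (FermionTorus 2 L)) => (((s ∩ SB).card : ℕ) : ℂ)) - (μs : ℂ) • (Matrix.diagonal fun s : Finset (Orb (FermionTorus 2 L)) => (((s ∩ SR).card : ℕ) : ℂ))) (totalNumber : Matrix (Finset (Orb (FermionTorus 2 L))) (Finset (Orb (FermionTorus 2 L))) ℂ)).re - c) ^ 2 + C * (1 + Real.sqrt (β * |h|)) * (L : ℝ) ^ 2 * (M : ℝ) ^ 2) := by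
  obtain ⟨C, hC0, hS4⟩ := stub_blockProduct
  refine ⟨max C (132 + 6 * Real.sqrt C), le_max_of_le_left hC0, ?_⟩
  intro L _ M hM hML a ha U μs h hU
  obtain ⟨SA, SB, SR, T₀, hdAB, hdAR, hdBR, hcov, hSR, hT₀, hdcA, hdcB, hsep, hPB⟩ := hS4 L M hM hML a ha U μs h hU
  have hCle : C ≤ max C (132 + 6 * Real.sqrt C) := le_max_left _ _
  have hM1 : (1 : ℝ) ≤ M := by exact_mod_cast hM
  have hM0 : (0 : ℝ) ≤ M := zero_le_one.trans hM1
  have hL0 : (0 : ℝ) ≤ L := Nat.cast_nonneg L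
  have hKM : ((L / M : ℕ) : ℝ) * M ≤ L := by exact_mod_cast Nat.div_mul_le_self L M
  have hK2 : ((L / M : ℕ) : ℝ) ^ 2 * (M : ℝ) ^ 2 ≤ (L : ℝ) ^ 2 := by
    rw [← mul_pow]
    exact pow_le_pow_left₀ (mul_nonneg (Nat.cast_nonneg _) hM0) hKM 2
  have haM : (a : ℝ) * (M : ℝ) ^ 2 ≤ (L : ℝ) ^ 2 := by
    have ha' : (a : ℝ) ≤ ((L / M : ℕ) : ℝ) ^ 2 := by exact_mod_cast ha
    exact (mul_le_mul_of_nonneg_right ha' (sq_nonneg _)).trans hK2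
  have hbM : (((L / M) ^ 2 - a : ℕ) : ℝ) * (M : ℝ) ^ 2 ≤ (L : ℝ) ^ 2 := by
    have hb' : (((L / M) ^ 2 - a : ℕ) : ℝ) ≤ ((L / M : ℕ) : ℝ) ^ 2 := by exact_mod_cast Nat.sub_le _ _
    exact (mul_le_mul_of_nonneg_right hb' (sq_nonneg _)).trans hK2
  have hcard : ((Fintype.card (Lex (Fin M × Fin M)) : ℕ) : ℝ) = (M : ℝ) ^ 2 := by
    rw [Fintype.card_lex, Fintype.card_prod, Fintype.card_fin]
    push_cast
    ring
  -- the three regional numbers: cover, commutation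
  have hN : (totalNumber : Matrix (Finset (Orb (FermionTorus 2 L))) (Finset (Orb (FermionTorus 2 L))) ℂ) =
      (Matrix.diagonal fun s : Finset (Orb (FermionTorus 2 L)) => (((s ∩ SA).card : ℕ) : ℂ)) +
        (Matrix.diagonal fun s : Finset (Orb (FermionTorus 2 L)) => (((s ∩ SB).card : ℕ) : ℂ)) +
        (Matrix.diagonal fun s : Finset (Orb (FermionTorus 2 L)) => (((s ∩ SR).card : ℕ) : ℂ)) := by
    rw [totalNumber_eq_numberDiag_univ (Λ := FermionTorus 2 L), orbs_univ, ← hcov,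
      numberDiag_union (Finset.disjoint_union_left.2 ⟨hdAR, hdBR⟩), numberDiag_union hdAB]
  have hAB := sub_eq_zero.mp (numberDiag_comm_diagonal SA (fun s : Finset (Orb (FermionTorus 2 L)) => (((s ∩ SB).card : ℕ) : ℂ)))
  have hAR := sub_eq_zero.mp (numberDiag_comm_diagonal SA (fun s : Finset (Orb (FermionTorus 2 L)) => (((s ∩ SR).card : ℕ) : ℂ)))
  have hBR := sub_eq_zero.mp (numberDiag_comm_diagonal SB (fun s : Finset (Orb (FermionTorus 2 L)) => (((s ∩ SR).card : ℕ) : ℂ)))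
  have hNM : (totalNumber : Matrix (Finset (Orb (Lex (Fin M × Fin M)))) (Finset (Orb (Lex (Fin M × Fin M)))) ℂ).IsHermitian := by
    rw [totalNumber_eq_numberDiag_univ (Λ := Lex (Fin M × Fin M))]
    exact isHermitian_numberDiag _
  -- the abstract moments at every `β > 0`
  have key := fun (β : ℝ) (hβ : 0 < β) =>
    tm_abstractMoments (μs := μs) (a := (a : ℝ)) (b := (((L / M) ^ 2 - a : ℕ) : ℝ))
      (fun μ : ℝ => tm_sourced_shift ((zdGraph 2).comap (fun p : (Lex (Fin M × Fin M)) => ![((ofLex p).1 : ℤ), ((ofLex p).2 : ℤ)])) 1 U h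
        (fun z : (Lex (Fin M × Fin M)) × (Lex (Fin M × Fin M)) => (fun v : Fin 2 → ℤ => ((dWaveFormFactor v / Real.sqrt 2 : ℝ) : ℂ)) (![((ofLex z.2).1 : ℤ), ((ofLex z.2).2 : ℤ)] - ![((ofLex z.1).1 : ℤ), ((ofLex z.1).2 : ℤ)])) μ)
      (isHermitian_sourced _ 1 U 0 h _) hNM hT₀ (isHermitian_numberDiag SA) (isHermitian_numberDiag SB)
      (isHermitian_numberDiag SR) hAB hAR hBR hN (Nat.cast_nonneg a) (Nat.cast_nonneg _) hβ
      (fun β' H hH => tm_re_gibbsState_totalNumber_mul_self_le hH β')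
      (fun β' H hH => tm_re_gibbsState_numberDiag_mul_self_le hH β' SR) hdcA hdcB ((hsep β hβ).imp fun R hR => hR.2)
  refine ⟨SA, SB, SR, T₀, hdAB, hdAR, hdBR, hcov, hSR, hT₀, hdcA.trans ?_, hdcB.trans ?_, fun β hβ => ?_,
    fun β hβ g hg μA μB => (hPB β hβ g hg μA μB).trans ?_, fun β hβ μA μB => (key β hβ).1 μA μB,
    fun β hβ μA μB c => ((key β hβ).2 μA μB c).trans ?_⟩
  · exact mul_le_mul_of_nonneg_right (mul_le_mul_of_nonneg_right hCle (abs_nonneg h)) (sq_nonneg _)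
  · exact mul_le_mul_of_nonneg_right (mul_le_mul_of_nonneg_right hCle (abs_nonneg h)) (sq_nonneg _)
  · obtain ⟨R, hR, hRsep⟩ := hsep β hβ
    refine ⟨R, hR.trans ?_, hRsep⟩
    have hF : 0 ≤ 1 + β * (U + |μs|) := add_nonneg zero_le_one (mul_nonneg hβ.le (add_nonneg hU (abs_nonneg _)))
    exact mul_le_mul_of_nonneg_right (mul_le_mul_of_nonneg_right (mul_le_mul_of_nonneg_right hCle hF) hL0) hM0
  · have h1 : (0 : ℝ) ≤ 1 + |h| := by positivity
    have h2 : (0 : ℝ) ≤ (L : ℝ) ^ 2 / M + L * M := by positivity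
    exact add_le_add le_rfl (mul_le_mul_of_nonneg_right (mul_le_mul_of_nonneg_right hCle h1) h2)
  · exact tm_collect hC0 (Real.sqrt_nonneg C) (Real.mul_self_sqrt hC0) hM1 (Nat.cast_nonneg a) (Nat.cast_nonneg _) haM hbM
      hcard (Nat.cast_nonneg _) hSR hβ.le (abs_nonneg h) (sq_nonneg _)

end

end Summit.HubbardSuperconductivity.HubbardSuperconductivity.Theorems.TwSeededEnsembleEquivalenceR.ColdFloorLine
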